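import Literature.NumberTheory.ModularForms.EisensteinEigenformGamma0Prime
import Literature.NumberTheory.EllipticCurves.EisensteinNewformLevelRaising
import Literature.NumberTheory.EllipticCurves.EisensteinNewformLevelRaisingDictionaryProofs
import Literature.NumberTheory.EllipticCurves.NewformsEigenpacketProofs
import Literature.NumberTheory.EllipticCurves.MurtySinhaMultiplicityHeckeProofs
import Literature.NumberTheory.EllipticCurves.NewformsLiftProofs
import Literature.NumberTheory.EllipticCurves.ModularCurveGenusBoundProofs
import HarnessLib

/-!
# Billerey–Menares 2018, Thm. 1, case `(N, k) = (1, 2)` (Mazur): the corner of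
# `BillereyMenares2018_exists_newform`, proved unconditionally

Topic `Literature/NumberTheory/EllipticCurves`; namespace `Literature.NumberTheory.EllipticCurves`
(helpers in `…EllipticCurves.ModularForms`).  THEOREMS ONLY (no definition, no named fact; D-0026).

`BillereyMenares2018_exists_newform` (`EisensteinNewformLevelRaising`) is Billerey–Menares'
Thm. 2 (⟸) with Thm. 1, in the `ι : ℚ̄_p ≃ ℂ` language.  Its case "`η̄ = χ_p` (so that the
hypothesis `hMazur` forces `M ≡ 1 (mod p)`) and `k = 2`" — the case `(N, k) = (1, 2)` of the
printed proof, which Billerey–Menares take from Mazur 1977, Prop. II.5.12 — is proved here WITHOUT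
the cuspidal-lift input (K) of `EisensteinNewformLevelRaisingReductionProofs`:

* `BillereyMenares2018_exists_newform_corner` : for `p ≥ 5`, `ι`, `η` with `η ≡ χ_p (mod 𝔭)`
  pointwise, `M ≠ p` prime with `M ≡ 1 (mod p)`, and `k = 2`, the conclusion of
  `BillereyMenares2018_exists_newform` holds (with `N' = M`, trivial nebentypus).

Proof.  `ModularForms.EisensteinCovector.exists_eigenform_eisenstein` (Mazur's Eisenstein
congruence through the homological Eisenstein covector and Deligne–Serre lifting) gives a non-zero
`g ∈ S₂(Γ₀(M))` with `T_ℓ g = α_ℓ g`, `α_ℓ` `ι`-integral, `α_ℓ ≡ 1 + ℓ` (`ℓ ≠ M`); its image in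
`S₂(M, 𝟙)` (`liftToGamma1`, `heckeT_liftToGamma1`) has the eigenvalue packet of a newform `g₀` of
level `M₀ ∣ M` (`exists_isNewform1_of_eigenpacket`, Atkin–Lehner–Li), and `M₀ = M` because
`S₂(Γ₁(1)) = 0` (`cuspForm_gamma1_one_weight_two_eq_zero`, from `g(X₀(1)) = 0`); the nebentypus of
`g₀` is trivial; `a_ℓ(g₀) = α_ℓ ≡ 1 + ℓ ≡ 1 + η(Frob_ℓ)` since `η(Frob_ℓ) ≡ χ_p(Frob_ℓ) = ℓ`
(`GaloisRep.cyclotomicCharacter_apply_of_isArithFrobAt`), and `a_p(g₀) ≡ 1 + p ≡ 1`.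

## References

* N. Billerey, R. Menares, *Strong modularity of reducible Galois representations*, Trans. Amer.
  Math. Soc. 370 (2018), Thm. 1 (1) and §3.2 ("if `N = 1` and `k = 2` … Mazur"). [BillereyMenares2018]
* B. Mazur, *Modular curves and the Eisenstein ideal*, Publ. Math. IHÉS 47 (1977), Prop. II.5.12,
  Prop. II.9.7. [Mazur1977]
-/

noncomputable section

open scoped MatrixGroups ModularForm
open CongruenceSubgroup UpperHalfPlane NumberField IsDedekindDomain
open Literature.NumberTheory.GaloisRepresentations
open Literature.NumberTheory.EllipticCurves.ModularForms

namespace Literature.NumberTheory.EllipticCurves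

namespace ModularForms

/-! ### `S₂(Γ₁(1)) = 0` -/

/-- **`S₂(Γ₀(1)) = 0`**: `g(X₀(1)) = 0` (`finrank_cuspForm_two_eq_genusX0_holds`, `gamma0_data_1`).
[cite: DiamondShurman2005, Thm. 3.5.1 with Thm. 3.1.1 (N = 1)] -/
theorem finrank_cuspForm_gamma0_one_weight_two : Module.finrank ℂ (CuspForm (Gamma0 1) 2) = 0 := by
  have h : Module.finrank ℂ (CuspForm (Gamma0 1) 2) = genusX0 1 := finrank_cuspForm_two_eq_genusX0_holds 1
  obtain ⟨h1, h2, h3, h4⟩ := gamma0_data_1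
  rw [h, genusX0, h1, h2, h3, h4]

/-- **`S₂(Γ₁(1)) = 0`** (every form of level `Γ₁(1)` is the lift of a `Γ₀(1)`-form).
[cite: DiamondShurman2005, Thm. 3.5.1 (N = 1)] -/
theorem cuspForm_gamma1_one_weight_two_eq_zero (f : CuspForm (Gamma1 1) 2) : f = 0 := by
  have hmem : f ∈ nebentypusSubspace 1 2 1 := by
    rw [MurtySinha.mem_nebentypusSubspace_one_iff]
    intro d
    rw [show ((d : (ZMod 1)ˣ) : ZMod 1) = 1 from Subsingleton.elim _ _, diamondOp_one_eq_id,
      LinearMap.id_apply]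
  obtain ⟨f₀, rfl⟩ := MurtySinha.exists_liftToGamma1_eq_of_mem_nebentypusSubspace_one (N := 1) (k := 2) hmem
  have hf₀ : f₀ = 0 := by
    have h := finrank_cuspForm_gamma0_one_weight_two
    rw [finrank_zero_iff_forall_zero] at h
    exact h f₀
  rw [hf₀, map_zero]

end ModularForms

variable {p : ℕ} [Fact p.Prime]

/-- `v(q) < 1` in `ℚ̄_p` for `p ∣ q`. [folklore] -/
private theorem v_natCast_lt_one_of_dvd' {n : ℕ} (h : p ∣ n) : Valued.v ((n : PadicAlgCl p)) < 1 := by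
  rw [PadicAlgCl.valuation_def, ← NNReal.coe_lt_coe, coe_nnnorm, NNReal.coe_one,
    ← map_natCast (algebraMap ℚ_[p] (PadicAlgCl p)), PadicAlgCl.norm_extends]
  exact Padic.norm_natCast_lt_one_iff.2 h

/-- **Billerey–Menares 2018, Thm. 1, in the corner `(N, k) = (1, 2)` (Mazur's case), proved
unconditionally.**  Let `p ≥ 5`, `ι : ℚ̄_p ≃ ℂ`, `η : Γ_ℚ → ℤ̄_pˣ` with `η ≡ χ_p (mod 𝔭)` pointwise
(the residual character is the mod-`p` cyclotomic character, i.e. `N = 1`), `k = 2`, and `M ≠ p` a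
prime with `M ≡ 1 (mod p)` (`= η̄(Frob_M) M ≡ 1`).  Then there is a newform `g` of weight `2` on
`Γ₁(M)` with trivial nebentypus (`M = cond · M`, order `1`), `p ∤ M`, `a_p(g) ≡ 1` and
`a_ℓ(g) ≡ 1 + η(Frob_ℓ)`, `𝟙(ℓ) ℓ ≡ η(Frob_ℓ)` for all primes `ℓ ∤ Mp` — the conclusion of
`BillereyMenares2018_exists_newform`.  From Mazur's Eisenstein congruence in the homological form
`ModularForms.EisensteinCovector.exists_eigenform_eisenstein` (no `q`-expansion principle, no
constant terms of Eisenstein series). [cite: BillereyMenares2018, Thm. 1 (1) and §3.2]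
[cite: Mazur1977, II.5 Prop. 5.12] -/
theorem BillereyMenares2018_exists_newform_corner (hp5 : 5 ≤ p) (ι : PadicAlgCl p ≃+* ℂ)
    (θ : Field.absoluteGaloisGroup ℚ →ₜ* (PadicAlgCl p)ˣ) (k M : ℕ) (hk : k = 2)
    (hM : M.Prime) (hMp : M ≠ p)
    (hcyc : ∀ τ, Valued.v (((θ τ : (PadicAlgCl p)ˣ) : PadicAlgCl p) -
        algebraMap (Padic p) (PadicAlgCl p)
          (((GaloisRep.cyclotomicCharacter ℚ p τ).val : PadicInt p) : Padic p)) < 1)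
    (hmod : M % p = 1) :
    ∃ (N : ℕ) (_ : NeZero N) (g : CuspForm (CongruenceSubgroup.Gamma1 N) k),
      IsNewform1 g ∧ ¬ p ∣ N ∧
      (N = (nebentypus g).conductor ∨ N = (nebentypus g).conductor * M) ∧
      (∃ m : ℕ, 0 < m ∧ ¬ p ∣ m ∧ nebentypus g ^ m = 1) ∧
      Valued.v (ι.symm ((UpperHalfPlane.qExpansion 1 ⇑g).coeff p) - 1) < 1 ∧
      ∀ ℓ : ℕ, ℓ.Prime → ¬ ℓ ∣ N → ℓ ≠ p →
        ∀ w : HeightOneSpectrum (𝓞 ℚ), (ℓ : 𝓞 ℚ) ∈ w.asIdeal → ∀ 𝔓 ∈ w.primesAbove,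
          ∀ σ : Field.absoluteGaloisGroup ℚ, IsArithFrobAt (𝓞 ℚ) σ 𝔓 →
            Valued.v (ι.symm ((UpperHalfPlane.qExpansion 1 ⇑g).coeff ℓ) -
                (1 + ((θ σ : (PadicAlgCl p)ˣ) : PadicAlgCl p))) < 1 ∧
            Valued.v (ι.symm ((nebentypus g (ℓ : ZMod N) : ℂ) * (ℓ : ℂ) ^ ((k : ℤ) - 1)) -
                ((θ σ : (PadicAlgCl p)ˣ) : PadicAlgCl p)) < 1 := by
  subst hk
  classical
  have hp : p.Prime := Fact.out
  haveI : Fact M.Prime := ⟨hM⟩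
  haveI : NeZero M := ⟨hM.ne_zero⟩
  -- `M ≡ 1 (mod p)`
  have hpM1 : p ∣ M - 1 :=
    (Nat.modEq_iff_dvd' hM.one_lt.le).1 (by rw [Nat.ModEq, Nat.mod_eq_of_lt hp.one_lt, hmod])
  have hpM : ¬ p ∣ M := fun h ↦ hMp ((Nat.prime_dvd_prime_iff_eq hp hM).1 h).symm
  -- ### Mazur's eigenform
  obtain ⟨g, hg0, hg⟩ :=
    Literature.NumberTheory.ModularForms.EisensteinCovector.exists_eigenform_eisenstein (p := p)
      (M := M) hp5 hpM1 ι
  have hex : ∀ q : ℕ, ∃ α : ℂ, ∀ (hq : q.Prime), q ≠ M →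
      (haveI : NeZero q := ⟨hq.ne_zero⟩; heckeT (Gamma0 M) 2 q g) = α • g ∧
        Valued.v (ι.symm α) ≤ 1 ∧ Valued.v (ι.symm α - ((q : PadicAlgCl p) + 1)) < 1 := by
    intro q
    by_cases h : q.Prime ∧ q ≠ M
    · haveI : NeZero q := ⟨h.1.ne_zero⟩
      obtain ⟨α, h1, h2, h3⟩ := hg q h.1 h.2
      exact ⟨α, fun _ _ ↦ ⟨h1, h2, h3⟩⟩
    · exact ⟨0, fun hq hqM ↦ absurd ⟨hq, hqM⟩ h⟩
  choose a ha using hex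
  -- ### the newform with the same packet (Atkin–Lehner–Li), of level `M`
  have hg'0 : liftToGamma1 M 2 g ≠ 0 := liftToGamma1_ne_zero (N := M) (k := 2) hg0
  have hg'c : liftToGamma1 M 2 g ∈ nebentypusSubspace M 2 1 :=
    MurtySinha.liftToGamma1_mem_nebentypusSubspace_one (N := M) (k := 2) g
  have hT : ∀ (q : ℕ) (hq : q.Prime), ¬ q ∣ M →
      (haveI : NeZero q := ⟨hq.ne_zero⟩; heckeT (Gamma1 M) 2 q (liftToGamma1 M 2 g)) =
        a q • liftToGamma1 M 2 g := by
    intro q hq hqM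
    haveI : NeZero q := ⟨hq.ne_zero⟩
    have hqM' : q ≠ M := fun h ↦ hqM (h ▸ dvd_rfl)
    obtain ⟨h1, -, -⟩ := ha q hq hqM'
    show heckeT (Gamma1 M) 2 q (liftToGamma1 M 2 g) = a q • liftToGamma1 M 2 g
    rw [heckeT_liftToGamma1, h1, map_smul]
  obtain ⟨M₀, _, hM₀, g₀, hnew, hcoef, hneb⟩ := exists_isNewform1_of_eigenpacket hg'0 hg'c hT
  -- `M₀ = M` since `S₂(Γ₁(1)) = 0`
  obtain rfl : M = M₀ := by
    rcases (Nat.dvd_prime hM).1 hM₀ with h | h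
    · subst h
      exact absurd (ModularForms.cuspForm_gamma1_one_weight_two_eq_zero g₀)
        (IsNormalized.ne_zero hnew.2.2.2)
    · exact h.symm
  -- the nebentypus is trivial
  have hnebM : nebentypus g₀ = 1 := by
    have h := hneb
    rwa [DirichletCharacter.changeLevel_self] at h
  -- ### reading off
  refine ⟨M, inferInstance, g₀, hnew, hpM, ?_, ⟨1, one_pos, hp.not_dvd_one, by rw [pow_one, hnebM]⟩,
    ?_, ?_⟩
  · right
    rw [hnebM, DirichletCharacter.conductor_one, one_mul]
  · -- `a_p(g₀) = α_p ≡ 1 + p ≡ 1`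
    obtain ⟨-, -, h3⟩ := ha p hp hMp.symm
    change Valued.v (ι.symm (cuspCoeff g₀ p) - 1) < 1
    rw [hcoef p hp hpM]
    have : ι.symm (a p) - 1 = (ι.symm (a p) - ((p : PadicAlgCl p) + 1)) + (p : PadicAlgCl p) := by ring
    rw [this]
    exact (Valuation.map_add _ _ _).trans_lt (max_lt h3 (v_natCast_lt_one_of_dvd' dvd_rfl))
  · -- the congruences at `ℓ ∤ Mp`
    intro ℓ hℓ hℓM hℓp w hw 𝔓 h𝔓 σ hσ
    have hℓM' : ℓ ≠ M := fun h ↦ hℓM (h ▸ dvd_rfl)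
    obtain ⟨-, -, h3⟩ := ha ℓ hℓ hℓM'
    -- `η(σ) ≡ χ_p(σ) = ℓ`
    have hpw : (p : 𝓞 ℚ) ∉ w.asIdeal := not_natCast_mem_asIdeal_of_ne hℓ hp hw hℓp
    have hcycσ : algebraMap (Padic p) (PadicAlgCl p)
        (((GaloisRep.cyclotomicCharacter ℚ p σ).val : PadicInt p) : Padic p) = (ℓ : PadicAlgCl p) := by
      rw [show (GaloisRep.cyclotomicCharacter ℚ p σ).val =
          ((GaloisRep.cyclotomicCharacter ℚ p σ : ℤ_[p]ˣ) : ℤ_[p]) from rfl,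
        GaloisRep.cyclotomicCharacter_apply_of_isArithFrobAt hpw h𝔓 hσ,
        residueCard_eq_of_natCast_mem_asIdeal hℓ hw]
      simp
    set e := ((θ σ : (PadicAlgCl p)ˣ) : PadicAlgCl p) with he
    have heℓ : Valued.v (e - (ℓ : PadicAlgCl p)) < 1 := by
      have h := hcyc σ
      rwa [hcycσ] at h
    constructor
    · change Valued.v (ι.symm (cuspCoeff g₀ ℓ) - (1 + e)) < 1
      rw [hcoef ℓ hℓ hℓM]
      have : ι.symm (a ℓ) - (1 + e) = (ι.symm (a ℓ) - ((ℓ : PadicAlgCl p) + 1)) + ((ℓ : PadicAlgCl p) - e) := by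
        ring
      rw [this]
      refine (Valuation.map_add _ _ _).trans_lt (max_lt h3 ?_)
      rw [Valuation.map_sub_swap]
      exact heℓ
    · rw [hnebM, MulChar.one_apply (ZMod.isUnit_prime_of_not_dvd hℓ hℓM), one_mul,
        show (((2 : ℕ) : ℤ) - 1) = 1 by norm_num, zpow_one, map_natCast, Valuation.map_sub_swap]
      exact heℓ

/-- **Reduction of `BillereyMenares2018_exists_newform` to its off-corner part.**  The named fact
follows from its restriction to the data OFF Mazur's corner, i.e. with the extra hypothesis
`¬ ((∀ τ, η(τ) ≡ χ_p(τ)) ∧ k = 2)`; the corner itself is `BillereyMenares2018_exists_newform_corner`.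
(Billerey–Menares, §3.2, treat exactly these two cases separately: "`N > 1` or `k > 2`" by the
level-raised Eisenstein series `E_k^{𝟙,χ} - χ(M)M^{k-1}E_k^{𝟙,χ}(M·)` … , "`N = 1` and `k = 2`" by Mazur.)
[cite: BillereyMenares2018, §3.2] -/
theorem BillereyMenares2018_exists_newform_of_offCorner
    (hoff : ∀ (p : ℕ) [Fact p.Prime], 5 ≤ p → ∀ (ι : PadicAlgCl p ≃+* ℂ)
      (θ : Field.absoluteGaloisGroup ℚ →ₜ* (PadicAlgCl p)ˣ) (k M : ℕ),
      (∀ τ, Valued.v ((θ τ : (PadicAlgCl p)ˣ) : PadicAlgCl p) = 1) →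
      (∀ c : Field.absoluteGaloisGroup ℚ, IsComplexConjugation (Rat.castHom ℝ) c →
        Valued.v (((θ c : (PadicAlgCl p)ˣ) : PadicAlgCl p) + 1) < 1) →
      2 ≤ k → k + 2 ≤ p →
      (∀ w : HeightOneSpectrum (𝓞 ℚ), (p : 𝓞 ℚ) ∈ w.asIdeal → ∃ 𝔓 ∈ w.primesAbove,
        ∀ σ ∈ 𝔓.inertia (Field.absoluteGaloisGroup ℚ),
          Valued.v (((θ σ : (PadicAlgCl p)ˣ) : PadicAlgCl p) -
            algebraMap (Padic p) (PadicAlgCl p)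
              (((GaloisRep.cyclotomicCharacter ℚ p σ).val : PadicInt p) : Padic p) ^ (k - 1)) < 1) →
      M.Prime → M ≠ p →
      (∀ w : HeightOneSpectrum (𝓞 ℚ), (M : 𝓞 ℚ) ∈ w.asIdeal → ∀ 𝔓 ∈ w.primesAbove,
        ∀ σ ∈ 𝔓.inertia (Field.absoluteGaloisGroup ℚ),
          Valued.v (((θ σ : (PadicAlgCl p)ˣ) : PadicAlgCl p) - 1) < 1) →
      (∀ w : HeightOneSpectrum (𝓞 ℚ), (M : 𝓞 ℚ) ∈ w.asIdeal → ∀ 𝔓 ∈ w.primesAbove,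
        ∀ σ : Field.absoluteGaloisGroup ℚ, IsArithFrobAt (𝓞 ℚ) σ 𝔓 →
          Valued.v (((θ σ : (PadicAlgCl p)ˣ) : PadicAlgCl p) * (M : PadicAlgCl p) - 1) < 1) →
      ((∀ τ, Valued.v (((θ τ : (PadicAlgCl p)ˣ) : PadicAlgCl p) -
          algebraMap (Padic p) (PadicAlgCl p)
            (((GaloisRep.cyclotomicCharacter ℚ p τ).val : PadicInt p) : Padic p)) < 1) → M % p = 1) →
      ¬ ((∀ τ, Valued.v (((θ τ : (PadicAlgCl p)ˣ) : PadicAlgCl p) -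
          algebraMap (Padic p) (PadicAlgCl p)
            (((GaloisRep.cyclotomicCharacter ℚ p τ).val : PadicInt p) : Padic p)) < 1) ∧ k = 2) →
      ∃ (N : ℕ) (_ : NeZero N) (g : CuspForm (CongruenceSubgroup.Gamma1 N) k),
        IsNewform1 g ∧ ¬ p ∣ N ∧
        (N = (nebentypus g).conductor ∨ N = (nebentypus g).conductor * M) ∧
        (∃ m : ℕ, 0 < m ∧ ¬ p ∣ m ∧ nebentypus g ^ m = 1) ∧
        Valued.v (ι.symm ((UpperHalfPlane.qExpansion 1 ⇑g).coeff p) - 1) < 1 ∧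
        ∀ ℓ : ℕ, ℓ.Prime → ¬ ℓ ∣ N → ℓ ≠ p →
          ∀ w : HeightOneSpectrum (𝓞 ℚ), (ℓ : 𝓞 ℚ) ∈ w.asIdeal → ∀ 𝔓 ∈ w.primesAbove,
            ∀ σ : Field.absoluteGaloisGroup ℚ, IsArithFrobAt (𝓞 ℚ) σ 𝔓 →
              Valued.v (ι.symm ((UpperHalfPlane.qExpansion 1 ⇑g).coeff ℓ) -
                  (1 + ((θ σ : (PadicAlgCl p)ˣ) : PadicAlgCl p))) < 1 ∧
              Valued.v (ι.symm ((nebentypus g (ℓ : ZMod N) : ℂ) * (ℓ : ℂ) ^ ((k : ℤ) - 1)) -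
                  ((θ σ : (PadicAlgCl p)ˣ) : PadicAlgCl p)) < 1) :
    BillereyMenares2018_exists_newform := by
  intro p _ hp5 ι θ k M hunit hodd hk2 hkp hIp hM hMp hIM hFrobM hMazur
  by_cases hcorner : (∀ τ, Valued.v (((θ τ : (PadicAlgCl p)ˣ) : PadicAlgCl p) -
      algebraMap (Padic p) (PadicAlgCl p)
        (((GaloisRep.cyclotomicCharacter ℚ p τ).val : PadicInt p) : Padic p)) < 1) ∧ k = 2
  · exact BillereyMenares2018_exists_newform_corner hp5 ι θ k M hcorner.2 hM hMp hcorner.1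
      (hMazur hcorner.1)
  · exact hoff p hp5 ι θ k M hunit hodd hk2 hkp hIp hM hMp hIM hFrobM hMazur hcorner

end Literature.NumberTheory.EllipticCurves
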